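import Literature.AnabelianGeometry.SemiGraphs.ArithBranchGeometricPartAt
import Literature.AnabelianGeometry.SemiGraphs.ArithEdgeLikeInfVerticial
import Literature.AnabelianGeometry.SemiGraphs.ArithTemperedGroupOfOuterAction
import Literature.AnabelianGeometry.SemiGraphs.TemperedVerticialNotEdgeLike
import Literature.AnabelianGeometry.SemiGraphs.TemperedThm37OfCompactInVerticialAt
import Literature.AnabelianGeometry.SemiGraphs.TemperedCompactInVerticialFinite
import HarnessLib

/-!
# [SemiAnbd] Thm 5.4 (ii), input `hVE` ("no verticial subgroup is edge-like") AT THE OUTER MODEL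
# `π₁^temp(𝒢) ⋊^out Π_A`, from Thm 3.7 (iii)/(iv) at `𝒢` — hypothesis-free at finite graphs

Mochizuki, *Semi-graphs of anabelioids*, Publ. RIMS **42** (2006), §5, Rmk 5.3.1 p. 65 and Thm 5.4 (ii)
p. 66 ("the proofs are entirely parallel to those of Theorem 3.7, Corollary 3.9"), with §3 Thm 3.7
(iii)/(iv) pp. 40–41 ("The maximal compact subgroups of `π₁^temp(𝒢)` are precisely the verticial
subgroups. The nontrivial intersections of two distinct maximal compact subgroups … are precisely the
edge-like subgroups"). [cite: MochizukiSemiAnbd2006, Thm 5.4 (ii), p. 66]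

PROOF-ONLY companion (no definition, no new named fact; cell abc-iut, L3 sub-DAG Thm 5.4, L3-lead
ruling α50 (1) «T54·hVE-inst», seat abc-iut-w5-d215).  The capstone binder of abc-iut-w4-d029's
`ArithThm54iiCapstoneOuterAction`

  `hVE : ∀ K, IsVerticial (decompositionDataOfChart Rc (toOuterSemidirectProduct ρ)) K →
           ¬ IsEdgeLike (decompositionDataOfChart Rc (toOuterSemidirectProduct ρ)) K`

is DISCHARGED here for the produced decomposition data (abc-iut-L3-t3/w4-d059, `decompositionDataOfChart`)
at the outer model `Π^temp_𝔊 := π₁^temp(𝒢) ⋊^out Π_A` of an ARBITRARY outer action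
`ρ : Π_A → Out_top(π₁^temp 𝒢)` (abc-iut-w4-d082 / L3-d2, `ArithTemperedGroupOfOuterAction`), from
Thm 3.7 (iii) at `𝒢` ALONE (binder `CompactInVerticialAt 𝒢`; (iv) at `𝒢` follows in the tree,
`maximalCompactIffVerticialAt_of_compactInVerticialAt`) — and HYPOTHESIS-FREE at every FINITE graph
(abc-iut-L3-t8 `compactInVerticialAt_of_finiteGraph`, p431007).  No base action, no `ArithChartAction`
package and no compatibility `hV`/`hE` is needed: by Thm 3.7 (iv) the verticial subgroups are the
MAXIMAL COMPACT subgroups and the nontrivial edge-like subgroups (all edges are closed in a graph) are the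
nontrivial meets of two distinct maximal compact subgroups, so EVERY bi-continuous automorphism of
`π₁^temp(𝒢)` — in particular the restriction `φ_g` of conjugation by any `g ∈ π₁^temp(𝒢) ⋊^out Π_A`
(`conj_toOuterSemidirectProduct`) — permutes the verticial subgroups and the edge-like subgroups.  This is
exactly the pair of inputs `hVout`/`hBout` of abc-iut-w4-d040's
`intersectionWithGeometricStatement_ofChartAt` (Rmk 5.3.1, second sentence, for the produced data), whence
`hVE` by abc-iut-w4-d085's `not_isEdgeLike_of_isVerticial_of_geometric` and the geometric disjointness
`isGeomVerticial_not_isGeomEdgeLike` (Thm 3.7).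

Contents: `isMaximalCompactSubgroup_map_of_continuous` (transport of maximal compact subgroups along a
bi-continuous automorphism), `exists_mem_verticialSubgroups_map_contMulAut_of_at` /
`exists_mem_edgeLikeSubgroups_map_contMulAut_of_at` (automorphism-invariance of the two classes of §3
subgroups, from (iv) at `𝒢`), the GENERIC LEVEL-A form over any `(Π^temp_𝔊, ι, aug)` whose inner
automorphisms restrict to bi-continuous automorphisms of `π₁^temp(𝒢)` (`…_ofChart_of_outerAt`), the
outer-model forms (`…_outerAction_of_at`) and the finite-graph forms (`…_of_finiteGraph`,
`…_of_finiteBranch`).  Pure group theory over the tree; nothing here asserts a hypothesis of Thm 5.4 for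
any data; typed ≠ proved elsewhere; nothing bears on [IUTchIII] Cor. 3.12.
-/

namespace Literature.AnabelianGeometry.SemiGraphs

open Literature.AnabelianGeometry.EtaleTheta

universe u u' w

/-! ### Transport of maximal compact subgroups along bi-continuous automorphisms -/

/-- A bi-continuous group automorphism carries maximal compact subgroups to maximal compact subgroups
(the notion of [SemiAnbd] Thm 3.7 (iv) / Def 3.8 is intrinsic to the topological group).
[cite: MochizukiSemiAnbd2006, Thm 3.7(iv) p.41] -/
theorem isMaximalCompactSubgroup_map_of_continuous {G : Type u} [Group G] [TopologicalSpace G]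
    (ψ : G ≃* G) (hc : Continuous ψ) (hc' : Continuous ψ.symm) {H : Subgroup G}
    (hH : IsMaximalCompactSubgroup H) : IsMaximalCompactSubgroup (H.map ψ.toMonoidHom) := by
  refine ⟨?_, fun H' hH' hle => ?_⟩
  · rw [Subgroup.coe_map]
    exact hH.1.image hc
  · have hpre : IsCompact ((H'.map ψ.symm.toMonoidHom : Subgroup G) : Set G) := by
      rw [Subgroup.coe_map]
      exact hH'.image hc'
    have hle' : H ≤ H'.map ψ.symm.toMonoidHom := fun k hk =>
      ⟨ψ k, hle ⟨k, hk, rfl⟩, ψ.symm_apply_apply k⟩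
    have heq := hH.2 _ hpre hle'
    refine le_antisymm (fun y hy => ?_) hle
    have hy' : ψ.symm y ∈ H := by
      rw [← heq]
      exact ⟨y, hy, rfl⟩
    exact ⟨ψ.symm y, hy', ψ.apply_symm_apply y⟩

namespace ProfiniteSemiGraph

open CategoryTheory Topology
open scoped Pointwise

variable {𝒢 : ProfiniteSemiGraph.{u}}

/-- In a graph (every branch abuts to a vertex) every edge is closed. (Local copy of the four-line
argument of `TemperedReconstructionEdgeMapProofs.isClosedEdge_of_isGraph`, to keep this file's imports on
the Thm 3.7-at-`𝒢` line.) [cite: MochizukiSemiAnbd2006, §1 p.11] -/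
private theorem isClosedEdge_of_isGraph' (h : 𝒢.graph.IsGraph) (e : 𝒢.graph.Edge) :
    𝒢.graph.IsClosedEdge e := by
  obtain ⟨b₁, b₂, hne, h₁, h₂, -⟩ := 𝒢.graph.two_branches e
  obtain ⟨w₁, hw₁⟩ := Option.isSome_iff_exists.mp (h.abuts_isSome b₁)
  obtain ⟨w₂, hw₂⟩ := Option.isSome_iff_exists.mp (h.abuts_isSome b₂)
  exact SemiGraph.isClosedEdge_of_abuts hne h₁ h₂ hw₁ hw₂

/-! ### Thm 3.7 (iv) at `𝒢`: bi-continuous automorphisms permute verticial and edge-like subgroups -/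

/-- **Verticial subgroups are permuted by every bi-continuous automorphism of `π₁^temp(𝒢)`** (Thm 3.7
(iv) at `𝒢`: verticial = maximal compact, an intrinsic notion): for `φ ∈ Aut_top(π₁^temp 𝒢)` and `H`
verticial at `v`, `φ(H)` is verticial at SOME vertex. [cite: MochizukiSemiAnbd2006, Thm 3.7(iv) p.41] -/
theorem exists_mem_verticialSubgroups_map_contMulAut_of_at (hiv : MaximalCompactIffVerticialAt 𝒢)
    (h37 : 𝒢.Thm37Hypotheses) (c : TemperedPiChart 𝒢) (φ : contMulAut c.G) {v : 𝒢.graph.Vertex}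
    {H : Subgroup c.G} (hH : H ∈ verticialSubgroups c v) :
    ∃ w : 𝒢.graph.Vertex, H.map (φ : MulAut c.G).toMonoidHom ∈ verticialSubgroups c w := by
  have hmax : IsMaximalCompactSubgroup H := ((hiv h37 c).1 H).2 ⟨v, hH⟩
  exact ((hiv h37 c).1 _).1 (isMaximalCompactSubgroup_map_of_continuous _ φ.2.1 φ.2.2 hmax)

/-- **Edge-like subgroups are permuted by every bi-continuous automorphism of `π₁^temp(𝒢)`**, `𝒢` a
GRAPH (all edges closed; Thm 3.7 (iv) at `𝒢`: the nontrivial edge-like subgroups are the nontrivial meets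
of two distinct maximal compact subgroups; the trivial one is fixed): for `φ ∈ Aut_top(π₁^temp 𝒢)` and
`L` edge-like for `e`, `φ(L)` is edge-like for SOME edge. [cite: MochizukiSemiAnbd2006, Thm 3.7(iv) p.41] -/
theorem exists_mem_edgeLikeSubgroups_map_contMulAut_of_at (hiv : MaximalCompactIffVerticialAt 𝒢)
    (h37 : 𝒢.Thm37Hypotheses) (hG : 𝒢.graph.IsGraph) (c : TemperedPiChart 𝒢) (φ : contMulAut c.G)
    {e : 𝒢.graph.Edge} {L : Subgroup c.G} (hL : L ∈ edgeLikeSubgroups c e) :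
    ∃ e' : 𝒢.graph.Edge, L.map (φ : MulAut c.G).toMonoidHom ∈ edgeLikeSubgroups c e' := by
  by_cases hL0 : L = ⊥
  · subst hL0
    refine ⟨e, ?_⟩
    rwa [Subgroup.map_bot]
  · have hinj : Function.Injective (φ : MulAut c.G).toMonoidHom := (φ : MulAut c.G).injective
    obtain ⟨K₁, K₂, hK₁, hK₂, hne, hLK⟩ :=
      ((hiv h37 c).2 L hL0).2 ⟨e, isClosedEdge_of_isGraph' hG e, hL⟩
    have h0' : L.map (φ : MulAut c.G).toMonoidHom ≠ ⊥ := fun h =>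
      hL0 ((Subgroup.map_eq_bot_iff_of_injective L hinj).1 h)
    obtain ⟨e', -, hmem⟩ := ((hiv h37 c).2 _ h0').1
      ⟨K₁.map (φ : MulAut c.G).toMonoidHom, K₂.map (φ : MulAut c.G).toMonoidHom,
        isMaximalCompactSubgroup_map_of_continuous _ φ.2.1 φ.2.2 hK₁,
        isMaximalCompactSubgroup_map_of_continuous _ φ.2.1 φ.2.2 hK₂,
        fun h => hne (Subgroup.map_injective hinj h), by rw [hLK, Subgroup.map_inf K₁ K₂ _ hinj]⟩
    exact ⟨e', hmem⟩

/-! ### LEVEL A, generic: any `Π^temp_𝔊 ⊇ ι(π₁^temp 𝒢)` whose inner automorphisms restrict to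
bi-continuous automorphisms of `π₁^temp(𝒢)` -/

section Generic

variable {c : TemperedPiChart 𝒢} {Gtp : Type u'} [Group Gtp]

/-- **Rmk 5.3.1, second sentence, for the produced data — from Thm 3.7 (iii) at `𝒢` and an OUTER
restriction hypothesis only.**  Let `ι : π₁^temp(𝒢) ↪ Π^temp_𝔊` be injective with `ι(π₁^temp 𝒢) = ker(aug)`
and suppose every inner automorphism of `Π^temp_𝔊` restricts along `ι` to a bi-continuous automorphism
of `π₁^temp(𝒢)` (`hout`; automatic for the outer semi-direct product).  Then "the intersection with
`Π^temp_𝔾` of a verticial (resp. edge-like) subgroup of `Π^temp_𝔊` is a verticial (resp. edge-like)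
subgroup of `Π^temp_𝔾`" holds for `decompositionDataOfChart R ι`, the geometric predicates being "image
under `ι` of a §3 verticial (resp. edge-like) subgroup". [cite: MochizukiSemiAnbd2006, Rmk 5.3.1, p. 65] -/
theorem intersectionWithGeometricStatement_ofChart_of_outerAt (hiii : CompactInVerticialAt 𝒢)
    (h37 : 𝒢.Thm37Hypotheses) (hG : 𝒢.graph.IsGraph) (R : ChartRepresentatives c) (ι : c.G →* Gtp)
    (hι : Function.Injective ι) {PA : Type w} [Group PA] (aug : Gtp →* PA) (hexact : ι.range = aug.ker)
    (hout : ∀ g : Gtp, ∃ φ : contMulAut c.G, ∀ x : c.G, g * ι x * g⁻¹ = ι ((φ : MulAut c.G) x)) :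
    IntersectionWithGeometricStatement (decompositionDataOfChart R ι) aug
      (fun K => ∃ w : 𝒢.graph.Vertex, ∃ H ∈ verticialSubgroups c w, K = H.map ι)
      (fun K => ∃ e : 𝒢.graph.Edge, ∃ L ∈ edgeLikeSubgroups c e, K = L.map ι) := by
  have hiv : MaximalCompactIffVerticialAt 𝒢 := maximalCompactIffVerticialAt_of_compactInVerticialAt hiii
  -- conjugation by `g` on an image `ι(H)` is the image of `φ_g(H)`
  have hconj : ∀ (g : Gtp) (H : Subgroup c.G), ∃ φ : contMulAut c.G,
      conjSubgroup g (H.map ι) = (H.map (φ : MulAut c.G).toMonoidHom).map ι := by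
    intro g H
    obtain ⟨φ, hφ⟩ := hout g
    refine ⟨φ, ?_⟩
    ext y
    simp only [conjSubgroup, Subgroup.mem_map, MulEquiv.coe_toMonoidHom, MulAut.conj_apply,
      exists_exists_and_eq_and]
    constructor
    · rintro ⟨x, hx, rfl⟩
      exact ⟨x, hx, (hφ x).symm⟩
    · rintro ⟨x, hx, rfl⟩
      exact ⟨x, hx, hφ x⟩
  refine intersectionWithGeometricStatement_ofChartAt hiii h37 hG R ι hι aug hexact ?_ ?_
  · rintro g K ⟨w, H, hH, rfl⟩
    obtain ⟨φ, hφ⟩ := hconj g H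
    obtain ⟨w', hw'⟩ := exists_mem_verticialSubgroups_map_contMulAut_of_at hiv h37 c φ hH
    exact ⟨w', _, hw', hφ⟩
  · rintro g K ⟨e, L, hL, rfl⟩
    obtain ⟨φ, hφ⟩ := hconj g L
    obtain ⟨e', he'⟩ := exists_mem_edgeLikeSubgroups_map_contMulAut_of_at hiv h37 hG c φ hL
    exact ⟨e', _, he', hφ⟩

/-- **`hVE` for the produced data, LEVEL A generic, from Thm 3.7 (iii) at `𝒢`**: under the hypotheses of
`intersectionWithGeometricStatement_ofChart_of_outerAt` (injective `ι` onto `ker(aug)`, inner automorphisms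
of `Π^temp_𝔊` restricting bi-continuously), NO verticial subgroup of the produced decomposition data is
edge-like (T54 menu input `hVE`, row T54-2 "verticial ⇒ not edge-like").
[cite: MochizukiSemiAnbd2006, Thm 5.4 (ii), p. 66] -/
theorem not_isEdgeLike_of_isVerticial_ofChart_of_outerAt (hiii : CompactInVerticialAt 𝒢)
    (h37 : 𝒢.Thm37Hypotheses) (hG : 𝒢.graph.IsGraph) (R : ChartRepresentatives c) (ι : c.G →* Gtp)
    (hι : Function.Injective ι) {PA : Type w} [Group PA] (aug : Gtp →* PA) (hexact : ι.range = aug.ker)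
    (hout : ∀ g : Gtp, ∃ φ : contMulAut c.G, ∀ x : c.G, g * ι x * g⁻¹ = ι ((φ : MulAut c.G) x))
    {K : Subgroup Gtp} (hK : IsVerticial (decompositionDataOfChart R ι) K) :
    ¬ IsEdgeLike (decompositionDataOfChart R ι) K :=
  not_isEdgeLike_of_isVerticial_of_geometric
    (intersectionWithGeometricStatement_ofChart_of_outerAt hiii h37 hG R ι hι aug hexact hout)
    (fun K hKv => isGeomVerticial_not_isGeomEdgeLike h37 c ι hι K hKv) hK

end Generic

/-! ### The outer model `π₁^temp(𝒢) ⋊^out Π_A` (abc-iut-w4-d029's capstone currency) -/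

section OuterModel

variable (c : TemperedPiChart 𝒢) {PA : Type w} [Group PA] (ρ : PA →* TopOut c.G)

/-- For the outer semi-direct product `π₁^temp(𝒢) ⋊^out Π_A`, conjugation by any element restricts along
`ι = toOuterSemidirectProduct ρ` to a bi-continuous automorphism of `π₁^temp(𝒢)` (its `Aut`-component;
`conj_toOuterSemidirectProduct`). [cite: MochizukiSemiAnbd2006, §0 p.5] -/
theorem exists_contMulAut_conj_toOuterSemidirectProduct (g : outerSemidirectProduct ρ) :
    ∃ φ : contMulAut c.G, ∀ x : c.G,
      g * toOuterSemidirectProduct ρ x * g⁻¹ = toOuterSemidirectProduct ρ ((φ : MulAut c.G) x) :=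
  ⟨g.1.1, fun x => conj_toOuterSemidirectProduct ρ g x⟩

/-- **Rmk 5.3.1, second sentence, at the outer model `π₁^temp(𝒢) ⋊^out Π_A`** — for ANY outer action
`ρ`, from Thm 3.7 (iii) at `𝒢` (binder `CompactInVerticialAt 𝒢`; exactness of
`1 → π₁^temp(𝒢) → π₁^temp(𝒢) ⋊^out Π_A → Π_A → 1` is the tree's `outerAction_exact`, temp-slimness).
[cite: MochizukiSemiAnbd2006, Rmk 5.3.1, p. 65] -/
theorem intersectionWithGeometricStatement_outerAction_of_at (hiii : CompactInVerticialAt 𝒢)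
    (h37 : 𝒢.Thm37Hypotheses) (hG : 𝒢.graph.IsGraph) (R : ChartRepresentatives c) :
    IntersectionWithGeometricStatement (decompositionDataOfChart R (toOuterSemidirectProduct ρ))
      (outerSemidirectProductSnd ρ)
      (fun K => ∃ w : 𝒢.graph.Vertex, ∃ H ∈ verticialSubgroups c w,
        K = H.map (toOuterSemidirectProduct ρ))
      (fun K => ∃ e : 𝒢.graph.Edge, ∃ L ∈ edgeLikeSubgroups c e,
        K = L.map (toOuterSemidirectProduct ρ)) := by
  obtain ⟨hι, hex, -⟩ := outerAction_exact c ρ h37.toProp36Hypotheses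
  exact intersectionWithGeometricStatement_ofChart_of_outerAt hiii h37 hG R _ hι
    (outerSemidirectProductSnd ρ) hex (exists_contMulAut_conj_toOuterSemidirectProduct c ρ)

/-- **`hVE` AT THE OUTER MODEL, At-form** (T54·hVE-inst; the binder `hVE` of abc-iut-w4-d029's
`arithMaximalCompactStatementII_outerAction_piPresentation`, for ANY chart `c`, ANY outer action `ρ` and
ANY compatible representatives `R`): from Thm 3.7 (iii) at `𝒢` alone, no verticial subgroup of
`decompositionDataOfChart R (toOuterSemidirectProduct ρ)` is edge-like.
[cite: MochizukiSemiAnbd2006, Thm 5.4 (ii), p. 66] -/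
theorem not_isEdgeLike_of_isVerticial_outerAction_of_at (hiii : CompactInVerticialAt 𝒢)
    (h37 : 𝒢.Thm37Hypotheses) (hG : 𝒢.graph.IsGraph) (R : ChartRepresentatives c)
    {K : Subgroup (outerSemidirectProduct ρ)}
    (hK : IsVerticial (decompositionDataOfChart R (toOuterSemidirectProduct ρ)) K) :
    ¬ IsEdgeLike (decompositionDataOfChart R (toOuterSemidirectProduct ρ)) K := by
  obtain ⟨hι, hex, -⟩ := outerAction_exact c ρ h37.toProp36Hypotheses
  exact not_isEdgeLike_of_isVerticial_ofChart_of_outerAt hiii h37 hG R _ hι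
    (outerSemidirectProductSnd ρ) hex (exists_contMulAut_conj_toOuterSemidirectProduct c ρ) hK

/-- **`hVE` AT THE OUTER MODEL, At-form with both Thm 3.7 (iii) and (iv) binders** (the literal shape
of L3-lead α50 (1) "hiii/hiv binders"; `hiv` is in fact implied by `hiii`,
`maximalCompactIffVerticialAt_of_compactInVerticialAt`, and is not used).
[cite: MochizukiSemiAnbd2006, Thm 5.4 (ii), p. 66] -/
theorem not_isEdgeLike_of_isVerticial_outerAction_of_at' (hiii : CompactInVerticialAt 𝒢)
    (_hiv : MaximalCompactIffVerticialAt 𝒢) (h37 : 𝒢.Thm37Hypotheses) (hG : 𝒢.graph.IsGraph)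
    (R : ChartRepresentatives c) :
    ∀ K : Subgroup (outerSemidirectProduct ρ),
      IsVerticial (decompositionDataOfChart R (toOuterSemidirectProduct ρ)) K →
        ¬ IsEdgeLike (decompositionDataOfChart R (toOuterSemidirectProduct ρ)) K :=
  fun _ hK => not_isEdgeLike_of_isVerticial_outerAction_of_at c ρ hiii h37 hG R hK

/-- **`hVE` AT THE OUTER MODEL, HYPOTHESIS-FREE AT FINITE GRAPHS** ([SemiAnbd] Thm 3.7 (iii) is a
THEOREM at every finite graph: abc-iut-L3-t8 `compactInVerticialAt_of_finiteGraph`, p431007): for a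
finite graph of anabelioids `𝒢` satisfying the hypotheses of Thm 3.7, any chart, any outer action `ρ`,
any representatives, no verticial subgroup of the produced decomposition data at `π₁^temp(𝒢) ⋊^out Π_A`
is edge-like — the capstone binder `hVE` discharged. [cite: MochizukiSemiAnbd2006, Thm 5.4 (ii), p. 66] -/
theorem not_isEdgeLike_of_isVerticial_outerAction_of_finiteGraph [Finite 𝒢.graph.Vertex]
    [Finite 𝒢.graph.Edge] (h37 : 𝒢.Thm37Hypotheses) (hG : 𝒢.graph.IsGraph) (R : ChartRepresentatives c) :
    ∀ K : Subgroup (outerSemidirectProduct ρ),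
      IsVerticial (decompositionDataOfChart R (toOuterSemidirectProduct ρ)) K →
        ¬ IsEdgeLike (decompositionDataOfChart R (toOuterSemidirectProduct ρ)) K :=
  fun _ hK => not_isEdgeLike_of_isVerticial_outerAction_of_at c ρ
    compactInVerticialAt_of_finiteGraph h37 hG R hK

/-- **`hVE` AT THE OUTER MODEL, finite-BRANCH form** (the instance binders `[Finite 𝒢.graph.Vertex]`
`[Finite 𝒢.graph.Branch]` of abc-iut-w4-d029's capstones): the same, finitely many branches giving
finitely many edges. [cite: MochizukiSemiAnbd2006, Thm 5.4 (ii), p. 66] -/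
theorem not_isEdgeLike_of_isVerticial_outerAction_of_finiteBranch [Finite 𝒢.graph.Vertex]
    [Finite 𝒢.graph.Branch] (h37 : 𝒢.Thm37Hypotheses) (hG : 𝒢.graph.IsGraph)
    (R : ChartRepresentatives c) :
    ∀ K : Subgroup (outerSemidirectProduct ρ),
      IsVerticial (decompositionDataOfChart R (toOuterSemidirectProduct ρ)) K →
        ¬ IsEdgeLike (decompositionDataOfChart R (toOuterSemidirectProduct ρ)) K :=
  -- every edge has a branch (`SemiGraph.two_branches`), cf. `finite_edge_of_finite_branch` of
  -- `ImmersionLiftUnique.lean` (not imported here to keep this file on the Thm 3.7-at-`𝒢` line)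
  haveI : Finite 𝒢.graph.Edge := Finite.of_surjective 𝒢.graph.edgeOf fun e => by
    obtain ⟨b₁, -, -, h₁, -⟩ := 𝒢.graph.two_branches e
    exact ⟨b₁, h₁⟩
  not_isEdgeLike_of_isVerticial_outerAction_of_finiteGraph c ρ h37 hG R

end OuterModel

end ProfiniteSemiGraph

end Literature.AnabelianGeometry.SemiGraphs
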